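import Mathlib.Algebra.Field.TransferInstance
import Mathlib.Algebra.Ring.TransferInstance
import Summits.ABC.IUTFork.LanaLogLinkFrobenius
import HarnessLib

/-!
# L-LANA objects VI sexies: the field `K̄_v(logF)` on `O^{×μ}_v` ("new multiplication") and the log-link as a field isomorphism, at the `ℚ_p` datum

Record-only file (D-0012; seat abc-iut-c312-4, L-LANA level, plan/LLANA-SPEC N10 (HF) "`K̄_v(logF)`" and N12 (the
log-link on Frobenius-like data)); TAKES NO SIDE on [IUTchIII] Cor. 3.12. Over `LanaLogLinkFrobenius.lean` (this seat:
`padicLogIso : O^{×μ}_{ℚ̄_p} ≃* (ℚ̄_p, +)`, LANA p. 26's "`log : O^{×μ}_v ⥲ K̄_v`" REAL from L4's Iwasawa logarithm).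

LANA §5.1 (a) p. 27: "From the given action `Π_v(F) ↷ O^▷_v(F)` one can construct ([AbsTopIII, Prop. 3.2 (iii),(v)])
the 'new multiplication' on `O^{×μ}_v(F)` so that, with the original monoid multiplication regarded as the 'new
addition,' it becomes a field isomorphic to `K̄_v` on which `Π_v` acts. Let us denote the field (acted on by `Π_v`)
thus obtained by `K̄_v(logF)`"; §5.3 (a) p. 29: "one obtains a unique lift `log : †K̄_v(logF) ⥲ ‡K̄_v`. We call this
isomorphism a log-link". THIS file, at the `ℚ_p` datum (the anabelian CONSTRUCTION of the new multiplication from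
`Π_v ↷ O^▷_v` alone is [AbsTopIII] Prop. 3.2 content and is NOT claimed; here the structure is TRANSPORTED along the
real logarithm, which is what the construction yields in the model):

* `LogCarrier p` — the carrier `O^{×μ}_{ℚ̄_p}` of `K̄_v(logF)` (a type synonym, so that the transported ring structure
  does not collide with the group structure of `O^{×μ}`), `LogCarrier.equiv : LogCarrier p ≃ ℚ̄_p` (= `log`);
* `LogCarrier.instField` — **the field `K̄_v(logF)`**: the field structure of `ℚ̄_p` transported along `log`
  (Mathlib `Equiv.field`);
* **`LogCarrier.add_eq_mul` (PROVED)** — "with the original monoid multiplication regarded as the 'new addition'":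
  the new addition IS the multiplication of `O^{×μ}` (because `log` is a homomorphism `(O^{×μ}, ·) → (ℚ̄_p, +)`);
* **`logLink p : LogCarrier p ≃+* ℚ̄_p`** — the log-link `log : †K̄_v(logF) ⥲ ‡K̄_v` as an isomorphism of FIELDS (REAL),
  with `logLink_apply` (it is `log` on underlying classes) and `logLink_smul` (`G_{ℚ_p}`-equivariance: "a field
  isomorphic to `K̄_v` on which `Π_v` acts", here through `Π_v ↠ G_v`).

HONEST SCOPE: `ℚ_p` datum; transport, not reconstruction; the topology of `K̄_v(logF)` is not transported here.
[cite: LANA2026Report, §5.1 (a) p. 27, §5.3 (a) p. 29] [cite: MochizukiAbsTopIII2015, Definition 3.1 (iv) pp.68–69]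
NOT here: any judgement.
-/

noncomputable section

namespace Summit.ABC
namespace IUTFork

open scoped NNReal

variable (p : ℕ) [Fact p.Prime]

/-- **The carrier of `K̄_v(logF)`**: the group `O^{×μ}_{ℚ̄_p} = O^×/O^μ` (type synonym; its own ring structure below).
[cite: LANA2026Report, §5.1 (a) p. 27] -/
def LogCarrier : Type := UnitsModTorsion (padicVal p)

namespace LogCarrier

/-- The identification with `O^{×μ}` (identity on underlying terms). [cite: LANA2026Report, §5.1 (a) p. 27] -/
def ofUnitsModTorsion : UnitsModTorsion (padicVal p) ≃ LogCarrier p := Equiv.refl _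

/-- **`log : K̄_v(logF) ⥲ K̄_v` on carriers**: the real `log : O^{×μ}_{ℚ̄_p} ⥲ ℚ̄_p` (`padicLogIso`), as a bare bijection.
[cite: LANA2026Report, §5.1 p. 26] -/
def equiv : LogCarrier p ≃ PadicAlgCl p :=
  (padicLogIso p).toEquiv.trans Multiplicative.toAdd

/-- `equiv` on the class of a unit is `log` of the unit. [cite: LANA2026Report, §5.1 p. 26] -/
theorem equiv_apply (y : UnitsModTorsion (padicVal p)) :
    equiv p (ofUnitsModTorsion p y) = Multiplicative.toAdd (padicLogIso p y) := rfl

/-- **The field `K̄_v(logF)`** ("the 'new multiplication' on `O^{×μ}_v(F)` … it becomes a field isomorphic to `K̄_v`"):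
the field structure of `ℚ̄_p` transported to `O^{×μ}` along `log`. [cite: LANA2026Report, §5.1 (a) p. 27] -/
instance instField : Field (LogCarrier p) := (equiv p).field

/-- **"with the original monoid multiplication regarded as the 'new addition'"** (PROVED): the transported addition
of `K̄_v(logF)` is the multiplication of `O^{×μ}_v` — since `log (x · y) = log x + log y`.
[cite: LANA2026Report, §5.1 (a) p. 27] -/
theorem add_eq_mul (x y : UnitsModTorsion (padicVal p)) :
    ofUnitsModTorsion p x + ofUnitsModTorsion p y = ofUnitsModTorsion p (x * y) := by
  apply (equiv p).injective
  change (equiv p) ((equiv p).symm (equiv p (ofUnitsModTorsion p x) + equiv p (ofUnitsModTorsion p y))) = _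
  rw [Equiv.apply_symm_apply, equiv_apply, equiv_apply, equiv_apply, map_mul, toAdd_mul]

/-- The zero of `K̄_v(logF)` is the class `1 ∈ O^{×μ}` (`log 1 = 0`). [cite: LANA2026Report, §5.1 (a) p. 27] -/
theorem zero_eq_one_class : (0 : LogCarrier p) = ofUnitsModTorsion p 1 := by
  apply (equiv p).injective
  change (equiv p) ((equiv p).symm 0) = _
  rw [Equiv.apply_symm_apply, equiv_apply, map_one, toAdd_one]

/-- Negation in `K̄_v(logF)` is inversion in `O^{×μ}` (`log y⁻¹ = − log y`). [cite: LANA2026Report, §5.1 (a) p. 27] -/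
theorem neg_eq_inv_class (y : UnitsModTorsion (padicVal p)) :
    -(ofUnitsModTorsion p y) = ofUnitsModTorsion p y⁻¹ := by
  apply (equiv p).injective
  change (equiv p) ((equiv p).symm (-(equiv p (ofUnitsModTorsion p y)))) = _
  rw [Equiv.apply_symm_apply, equiv_apply, equiv_apply, map_inv, toAdd_inv]

end LogCarrier

/-- **The log-link `log : †K̄_v(logF) ⥲ ‡K̄_v` as an isomorphism of FIELDS** (REAL at the `ℚ_p` datum): by construction
of the transported structure, `log` is a ring isomorphism `K̄_v(logF) ≃+* ℚ̄_p`. [cite: LANA2026Report, §5.3 (a) p. 29] -/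
def logLink : LogCarrier p ≃+* PadicAlgCl p := (LogCarrier.equiv p).ringEquiv

/-- The log-link on the class of a unit `u` is `log u`. [cite: LANA2026Report, §5.3 (a) p. 29] -/
theorem logLink_apply (y : UnitsModTorsion (padicVal p)) :
    logLink p (LogCarrier.ofUnitsModTorsion p y) = Multiplicative.toAdd (padicLogIso p y) := rfl

/-- **`G_{ℚ_p}`-equivariance of the log-link** ("a field isomorphic to `K̄_v` on which `Π_v` acts", through `Π_v ↠ G_v`):
`log(σ · y) = σ(log y)` — `padicLogIso_smul` read through the field isomorphism. [cite: LANA2026Report, §5.1 (a) p. 27] -/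
theorem logLink_smul (σ : PadicGal p) (y : UnitsModTorsion (padicVal p)) :
    logLink p (LogCarrier.ofUnitsModTorsion p (σ • y)) = σ (logLink p (LogCarrier.ofUnitsModTorsion p y)) := by
  rw [logLink_apply, logLink_apply, padicLogIso_smul]

/-- The descended `G_{ℚ_p}`-action on `K̄_v(logF)`, transported: `σ ⋆ x := log⁻¹(σ(log x))`; by `logLink_smul` it agrees
with the action of `G_v` on `O^{×μ}_v` (so `K̄_v(logF)` "is acted on by `Π_v`" compatibly with `O^{×μ}`).
[cite: LANA2026Report, §5.1 (a) p. 27] -/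
theorem logLink_symm_smul (σ : PadicGal p) (y : UnitsModTorsion (padicVal p)) :
    (logLink p).symm (σ (logLink p (LogCarrier.ofUnitsModTorsion p y))) = LogCarrier.ofUnitsModTorsion p (σ • y) := by
  rw [← logLink_smul, RingEquiv.symm_apply_apply]

end IUTFork

end Summit.ABC

end
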